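import Summits.Ventures.Crystal3D.Theorems.StickyWulffConstantCoaxialWallLawTailResidueDefsT5
import HarnessLib

/-!
# Definition: LOCAL BARLOW RIGIDITY — the named dense-junk core of `stub_multiGrainSmallHigh` (crux `CoaxialWallLaw`, stmt-Ventures-19481;
# cf-p1 DECISION (clxxxix)(2))

HONEST FRAMING. Venture `Summits/Ventures/Crystal3D` (cell `crystal3d-full`); a DEFINITION for the crux `CoaxialWallLaw` (stmt-Ventures-19481,
`route-Ventures-StickyWulffConstant`), registered line 'CoaxialWallLawCertificates' v4, open stub `stub_multiGrainSmallHigh : KissingGap (5/2) →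
KissingClassification (5/2) → TailResidue.MultiGrainSmallHigh (2√6) 3`.  Nothing is claimed; F-C1 not moved.
WHY (memo HOME/wall-19481-p2/F-TAIL-g10.md §9–§10): the high-degree half of the seam stub splits into a STRUCTURED part (Barlow windows with jammed
dust — (C1) `…LatticeContacts`, (C2′) `…ModuleContactsBarlow`: a non-module ball touches `≤ 3` balls of a Barlow window, so a jammed payer is
under the line by `TailResidue.multiGrainSmallLow_three`; second-generation twin junctions, measured `≤ 1.25` and census-able) and a part NO census
reaches: «DENSE JUNK» — a payer of degree `≥ 6` whose loaded contacts are read only by NARROW readers of degree `11` inside degree-`12` material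
that is NOT lattice-arranged, where the census-free pool bound is `≈ deg z · 1 > 2√6` while no finite universe contains the window.  Whether
dense junk EXISTS is the local crystallisation question below; `KissingGap`/`KissingClassification` do not decide it (the pairwise gap of
`IsGapKissingConfig` is not implied for a dozen containing degree-`11` balls).  cf-p1 (clxxxix): «NAME it; no conditional closure now».
* **`LocalBarlowRigidity`** — in a `1`-separated configuration, a payer `z` (`6 ≤ deg z ≤ 11`) all of whose fellow balls within distance `3`
  have degree `≥ 11` sits in an ON-SITE window: `X ∩ B̄(z, 3)` is a coaxial-module pattern up to isometry (`OnSiteAt coaxialModuleUniverse X z`).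
  TARGET FOR cdisprove: a finite-radius non-module cluster with all degrees `≥ 11` around a ball of degree `6…11` refutes it (enumerate
  degree-`≥ 11` contact graphs within radius `3`; interval arithmetic à la Hales if needed).
* `exists_deficient_of_localBarlowRigidity` — the unpacking (an off-site payer window of degree `6…11` has a ball of degree `≤ 10` within `3`).
WHAT THIS DOES NOT GIVE: `LocalBarlowRigidity` alone does NOT imply `MultiGrainSmallHigh (2√6) 3` — under it an off-site payer window of degree
`≥ 6` contains a ball of degree `≤ 10` within distance `3`, and the remaining «deficiency-rich» regime still needs the structured census plus a
pool-propagation bound; the implication is therefore NOT typed here (cf-p1 (clxxxix): «if it is as direct as §10 suggests» — it is not).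
-/

noncomputable section

namespace Summit.Ventures.Crystal3D.Theorems

namespace TailResidue

open Summit.Ventures.Crystal3D Finset
open scoped InnerProductSpace

open scoped Classical in
/-- **LOCAL BARLOW RIGIDITY** (working name, cf-p1 (clxxxix)): in a `1`-separated finite configuration, if the payer `z` has `6 ≤ deg z ≤ 11` and
every other ball within distance `3` of `z` has at least `11` contacts, then the radius-`3` window of `z` is a coaxial-module pattern up to isometry
(`OnSiteAt coaxialModuleUniverse X z`).  The dense-junk core of `stub_multiGrainSmallHigh`; OPEN, no owner. -/
def LocalBarlowRigidity : Prop :=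
  ∀ X : Finset (EuclideanSpace ℝ (Fin 3)), (∀ p ∈ X, ∀ q ∈ X, p ≠ q → 1 ≤ dist p q) →
  ∀ z ∈ X, 6 ≤ (X.filter fun q => dist z q = 1).card → (X.filter fun q => dist z q = 1).card ≤ 11 →
    (∀ w ∈ X, w ≠ z → dist z w ≤ 3 → 11 ≤ (X.filter fun q => dist w q = 1).card) →
    OnSiteAt coaxialModuleUniverse X z

open scoped Classical in
/-- Unpacking: under `LocalBarlowRigidity`, an OFF-SITE payer window of degree `6 … 11` contains another ball of degree `≤ 10` within distance `3`. -/
theorem exists_deficient_of_localBarlowRigidity (h : LocalBarlowRigidity) {X : Finset (EuclideanSpace ℝ (Fin 3))}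
    (hX : ∀ p ∈ X, ∀ q ∈ X, p ≠ q → 1 ≤ dist p q) {z : EuclideanSpace ℝ (Fin 3)} (hz : z ∈ X)
    (h6 : 6 ≤ (X.filter fun q => dist z q = 1).card) (h11 : (X.filter fun q => dist z q = 1).card ≤ 11)
    (hoff : ¬ OnSiteAt coaxialModuleUniverse X z) :
    ∃ w ∈ X, w ≠ z ∧ dist z w ≤ 3 ∧ (X.filter fun q => dist w q = 1).card ≤ 10 := by
  by_contra hne
  push Not at hne
  exact hoff (h X hX z hz h6 h11 fun w hw hwz hd => by have := hne w hw hwz hd; omega)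

end TailResidue

end Summit.Ventures.Crystal3D.Theorems

end
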